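import Summits.ValiantsHypothesis.ValiantsHypothesis.Theorems.SymPencilPerFourColSixForms
import Summits.ValiantsHypothesis.ValiantsHypothesis.Theorems.SymPencilPerFourColSixTwoRow

/-!
# Route `SymPencil` — the column-deleted two-row space `W_col` at size `27`, IV: the PAIR LEMMA
# (`--supports` stmt-ValiantsHypothesis-5674 `SdcSuperquadratic`; cell `(10,6,6)`, rung currency only,
# nothing here bears on `VP ≠ VNP`)

`pair_vanish`: for the two-row kernel direction `v = t'a + tb` of `W_col`
(`a = E₀₁+E₀₂+E₀₃`, `b = β₁E₁₁+β₂E₁₂+β₃E₁₃`), if a kernel row `bL x'` of a `Z8`-vector `x'`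
(`x'₂₀ = x'₃₀ = 0`) is of the form `(D + CL v) D⁻¹ bL z''`, then the two linear forms
`s · x'₃'` and `s · x'₂'` vanish, `s = tt'((β₂+β₃),(β₁+β₃),(β₁+β₂))`: the base-point form
`bL z ⬝ (D+CL v)⁻¹ bL x'` is `0` (isotropy of `im bL`) and equals `-κ B_v(z,x')/det`
(`SymPencilPerFourColSixTwoRow.tworow_basepoint_form`), tested at `z = E₂₀, E₃₀`.  This is the
engine of the case analysis `(dim K_a, dim K_b) ∈ {7,8}²` that excludes `W_col`
(`Cruxes/SdcSuperquadratic/PENCIL-CROSS-27.md` rev 4 §W_col; assembly to follow in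
`SymPencilPerFourColSix`).  No definitions, no named facts. [folklore]
-/

noncomputable section

-- single-conjunct layout: Sub = Summit, duplicated namespace component intended
set_option linter.dupNamespace false

namespace Summit.ValiantsHypothesis.ValiantsHypothesis.Theorems.SymPencilPerFourColSixPair

open Matrix MvPolynomial Module
open Literature.Computability.AlgebraicComplexity
open Summit.ValiantsHypothesis.ValiantsHypothesis.Theorems.SymPencilLagrangianKernel
open Summit.ValiantsHypothesis.ValiantsHypothesis.Theorems.SymPencilAffineKernelLeverInvariance
open Summit.ValiantsHypothesis.ValiantsHypothesis.Theorems.SymPencilPerFourColSixForms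
open Summit.ValiantsHypothesis.ValiantsHypothesis.Theorems.SymPencilPerFourColSixTwoRow

universe u

variable {k : Type u} [Field k] [CharZero k] {ι' : Type*} [Fintype ι'] [DecidableEq ι']

/-- **Pair lemma.**  For the two-row direction `v = t'a + tb` (`b = β₁E₁₁+β₂E₁₂+β₃E₁₃`,
`bL v = 0`): if `y' = (D + CL v) D⁻¹ y''` with `y'' ∈ im bL` and `y' = bL x'` for a complement
vector `x'` of `Z8`-type (`x'₂₀ = x'₃₀ = 0`), then `s · x'₃' = 0` and `s · x'₂' = 0`,
`s = tt'((β₂+β₃), (β₁+β₃), (β₁+β₂))`. [folklore] -/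
theorem pair_vanish {D : Matrix ι' ι' k} (hDs : Dᵀ = D)
    (bL : (Fin 4 × Fin 4 → k) →ₗ[k] (ι' → k)) (CL : (Fin 4 × Fin 4 → k) →ₗ[k] Matrix ι' ι' k)
    (hCs : ∀ z, (CL z)ᵀ = CL z) {κ : k} (hκ : κ ≠ 0)
    (hi : ∀ z, bL z ⬝ᵥ D⁻¹ *ᵥ bL z = 0)
    (hN : ∀ v, bL v = 0 → IsUnit (D + CL v).det ∧ ∀ (z : Fin 4 × Fin 4 → k) (s : k),
      κ * MvPolynomial.eval (v + s • z) (perPoly (Fin 4) k) =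
        (Matrix.fromBlocks ((s * 0) • (1 : Matrix Unit Unit k))
          (Matrix.replicateRow Unit (s • bL z)) (Matrix.replicateCol Unit (s • bL z))
          (D + CL v + s • CL z)).det)
    (β₁ β₂ β₃ t t' : k)
    (hv : bL (fun w : Fin 4 × Fin 4 =>
        (Matrix.of ![![0, t', t', t'], ![0, t * β₁, t * β₂, t * β₃], ![0, 0, 0, 0], ![0, 0, 0, 0]])
          w.1 w.2) = 0)
    (x' z'' : Fin 4 × Fin 4 → k) (h20 : x' (2, 0) = 0) (h30 : x' (3, 0) = 0)
    (hy : bL x' = ((D + CL (fun w : Fin 4 × Fin 4 =>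
        (Matrix.of ![![0, t', t', t'], ![0, t * β₁, t * β₂, t * β₃], ![0, 0, 0, 0], ![0, 0, 0, 0]])
          w.1 w.2)) * D⁻¹) *ᵥ bL z'') :
    t * t' * ((β₂ + β₃) * x' (3, 1) + (β₁ + β₃) * x' (3, 2) + (β₁ + β₂) * x' (3, 3)) = 0 ∧
      t * t' * ((β₂ + β₃) * x' (2, 1) + (β₁ + β₃) * x' (2, 2) + (β₁ + β₂) * x' (2, 3)) = 0 := by
  set v : Fin 4 × Fin 4 → k := fun w : Fin 4 × Fin 4 =>
    (Matrix.of ![![0, t', t', t'], ![0, t * β₁, t * β₂, t * β₃], ![0, 0, 0, 0], ![0, 0, 0, 0]])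
      w.1 w.2 with hvdef
  have hu : IsUnit (D + CL v).det := (hN v hv).1
  have hDis : (D⁻¹)ᵀ = D⁻¹ := by rw [Matrix.transpose_nonsing_inv, hDs]
  -- `bL z ⬝ (D+CL v)⁻¹ bL x' = bL z ⬝ D⁻¹ bL z'' = 0`
  have hzero : ∀ z, bL z ⬝ᵥ (D + CL v)⁻¹ *ᵥ bL x' = 0 := by
    intro z
    rw [hy, Matrix.mulVec_mulVec, ← Matrix.mul_assoc, Matrix.nonsing_inv_mul _ hu, Matrix.one_mul]
    have h := hi (z + z'')
    rw [map_add, Matrix.mulVec_add, dotProduct_add, add_dotProduct, add_dotProduct, hi z, hi z'',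
      dotProduct_mulVec_of_transpose_eq hDis (bL z''), dotProduct_comm (_ *ᵥ bL z''), zero_add,
      add_zero, ← two_mul] at h
    exact (mul_eq_zero.1 h).resolve_left two_ne_zero
  have hform := fun z => tworow_basepoint_form hDs bL CL hCs hκ hN β₁ β₂ β₃ t t' hv z x'
  have e20 := hform (fun w : Fin 4 × Fin 4 =>
    (Matrix.of ![![(0 : k), 0, 0, 0], ![0, 0, 0, 0], ![1, 0, 0, 0], ![0, 0, 0, 0]]) w.1 w.2)
  have e30 := hform (fun w : Fin 4 × Fin 4 =>
    (Matrix.of ![![(0 : k), 0, 0, 0], ![0, 0, 0, 0], ![0, 0, 0, 0], ![1, 0, 0, 0]]) w.1 w.2)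
  rw [hzero, mul_zero] at e20 e30
  simp only [Matrix.of_apply, Matrix.cons_val, h20, h30, mul_zero, zero_mul, add_zero,
    zero_add, mul_one, one_mul] at e20 e30
  constructor
  · have h : κ * (t * t' * ((β₂ + β₃) * x' (3, 1) + (β₁ + β₃) * x' (3, 2) + (β₁ + β₂) * x' (3, 3))) =
        0 := by linear_combination (2 : k) * e20
    exact (mul_eq_zero.1 h).resolve_left hκ
  · have h : κ * (t * t' * ((β₂ + β₃) * x' (2, 1) + (β₁ + β₃) * x' (2, 2) + (β₁ + β₂) * x' (2, 3))) =
        0 := by linear_combination (2 : k) * e30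
    exact (mul_eq_zero.1 h).resolve_left hκ

end Summit.ValiantsHypothesis.ValiantsHypothesis.Theorems.SymPencilPerFourColSixPair

end
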